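import Summits.BirchSwinnertonDyer.Rank1Residual.AdditivePotMult.SelmerInftyTrivialPotMult
import Summits.BirchSwinnertonDyer.Rank1Residual.AdditivePotMult.PotMultBudgetRankZeroEnds
import Summits.BirchSwinnertonDyer.Rank1Residual.AdditivePotMult.PotMultX3PartnerMinimal
import HarnessLib

/-!
# X4(M) / X3♯(M) ∧ `r_an = 0`: `BSD(E,p)` from the record at index `b` and a TRIVIAL (M)-at-`p`
# CONGRUENT PARTNER — `#Sel_{p^∞}(E₁/ℚ) = 1` plus numeric tests at its bad places, NO Kato half /
# unit-coefficient certificate / image hypothesis on the partner (team n1011, row T-T3M, seat p12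
# GEN 9; file F6-M = the Route-G consumer of F5-M `PotMult.subsingleton_X_of_card_selmer_eq_one_*`)

HONEST FRAMING (cell `b2b-bsdres`, run/shared/lean/b2b/bsd-rank1-residual/, verbatim in every
file): the goal of the cell is to DELETE the COMBINATION-SHAPED residual classes of the
Birch–Swinnerton-Dyer formula for ALL analytic-rank `≤ 1` elliptic curves over `ℚ` — "full BSD
formula for every rank `≤ 1` curve in class `C`" assembled STRICTLY from published theorems — so
that the rank-`≤ 1` remainder becomes exactly the CONSTRUCTION-SHAPED classes, which are TYPED
(missing-input `Prop`s), NOT attempted. This is not "finishing BSD". Team n1011 (N10/N11; row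
T-T3M, skeleton `cells/n1011/skel/T-T3M.md`; Route G (ROUTE-2 §II.9/II.10) on the (M) rows):
research route; no claim beyond stated classes; census output = EVIDENCE, never a Literature fact;
RESIDUAL-MAP marks UNCHANGED; nothing is booked by this file. Theorems only; NO definition; NO new
named fact (the registered PUBLISHED facts of the existing Route-G (M) ENDs — Kato 17.4 via
Wuthrich 2014 (receiver side only), Delbourgo 1998 Prop. 4 (both clauses), Pal 2012, GZK, modularity,
a modular parametrisation — plus A41 `Silverman1994_thmV53_corV54_tateUniformisation` enter as
hypotheses exactly as in `PotMultBudgetRankZeroEnds` / `PotMultX3PartnerMinimal`). PER PAIR; X4(M)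
and X3♯(M) stay CONSTRUCTION-SHAPED.

## What

The cell's Route-G ENDs on the (M) rows
(`ClassX4M.bsdp_rankZero_of_surj_of_katoHalf_of_firstUnitIndex_of_congruentPartner`,
`ClassX3M.bsdp_rankZero_of_wuthrichHalf_of_firstUnitIndex_of_congruentPartner`) take a partner input
`h₁ : ∀ κ γ, κ.IsCyclotomic → κ.IsTopGenerator γ → IsCyclotomicVariable p γ → ∀ D₁,
D₁.IsTorsion ∧ D₁.mu = 0 ∧ r₁ ≤ λ(D₁.X)` for a partner `W₁` of ANY reduction type; the composed forms
in the tree feed it from the partner's Kato half + unit-coefficient certificate + surjectivity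
(`…_of_multPartner[_odd]`). THIS FILE feeds it, for a partner `E₁` that is (M) AT `p` with
`#Sel_{p^∞}(E₁/ℚ) = 1`, from F5-M: `X(E₁/ℚ_∞) = 0` (so `r₁ = 0`, torsion, `μ = λ = 0`), the partner's
other bad places tested numerically (`p ∤ c_ℓ · #Ẽ_ns(𝔽_ℓ)`, or additive at `p ≥ 5`):

* `ClassX4M.bsdp_rankZero_of_surj_of_katoHalf_of_firstUnitIndex_of_trivialPotMultPartner` (any odd
  `p`; partner places numeric) and `…_of_trivialPotMultPartner_of_additive_away` (`p ≥ 5`);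
* `ClassX3M.bsdp_rankZero_of_wuthrichHalf_of_firstUnitIndex_of_trivialPotMultPartner` (X3♯(M)
  receiver; no image hypothesis anywhere).
Per pair the residual inputs are: the receiver's record at index `b ≤ e` (`CongruentLambdaShift W W₁ p e`,
`TorsionIso W W₁ p`), and on the partner ONLY `PotMult W₁ p`, `#Sel_{p^∞}(E₁/ℚ) = 1`, the finite set
of bad places with their numeric tests — the X9 / X10b / T3-LIT "trivial partner" road, now on (M).

References: [GreenbergLNM1716] §3 Prop. 3.8 (pp. 95–96); [GreenbergVatsal2000] §2; [Kato2004Asterisque]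
Thm. 17.4 (3); [Wuthrich2014] Thm. 16; [Delbourgo1998] Prop. 4 (p. 144), §2.2 Lemma (p. 139);
[EmertonPollackWeston2006] Thm. 3.3.3 (schema); cells/n1011/skel/T-T3M.md; ROUTE-2 §II.9–II.10.
-/

noncomputable section

open scoped Classical NumberField

namespace Summit.BirchSwinnertonDyer.Rank1Residual.AdditivePotMult

open WeierstrassCurve NumberField Literature.NumberTheory.EllipticCurves
  Literature.NumberTheory.EllipticCurves.ModularForms
  Literature.NumberTheory.EllipticCurves.Rank1Residual
  Literature.NumberTheory.EllipticCurves.Rank1Residual.Typed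
  Literature.NumberTheory.EllipticCurves.GreenbergVatsal2000
  Literature.NumberTheory.GaloisRepresentations
  Summit.BirchSwinnertonDyer.Rank1Residual.Additive
  Summit.BirchSwinnertonDyer.Rank1Residual.Additive.CensusQ6
  Summit.BirchSwinnertonDyer.Rank1Residual.Iwasawa
  IsDedekindDomain Rat.HeightOneSpectrum

open Summit.BirchSwinnertonDyer.Rank1Residual.X1.CongruenceTransfer (TorsionIso CongruentLambdaShift)

variable {W W₁ : WeierstrassCurve ℚ} [W.IsElliptic] [W.IsGloballyMinimal] [W₁.IsElliptic]
  [W₁.IsGloballyMinimal] {p : ℕ} [hp : Fact p.Prime]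

/-- **The partner input `h₁` (with `r₁ = 0`) for a TRIVIAL (M)-at-`p` partner**: `PotMult W₁ p`,
`#Sel_{p^∞}(E₁/ℚ) = 1`, every bad `v ∤ p` of `E₁` by the numeric test — then for every cyclotomic
`κ`, generator `γ` and dual datum, `X(E₁/ℚ_∞)` is torsion with `μ = 0` and `0 ≤ λ` (indeed `X = 0`,
F5-M), mod A41. [cite: GreenbergLNM1716, §3 Prop. 3.8 and Remark (pp. 95–96)] -/
theorem PotMult.partnerInput_of_card_selmer_eq_one_numeric
    (hT41 : Silverman1994_thmV53_corV54_tateUniformisation.{0}) (hpm₁ : PotMult W₁ p) (hp2 : p ≠ 2)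
    (hSel₁ : Nat.card (W₁.selmerGroupPInfty p) = 1) (S₁ : Finset (HeightOneSpectrum (𝓞 ℚ)))
    (hS₁ : ∀ v ∈ S₁, (p : 𝓞 ℚ) ∉ v.asIdeal →
      (primesEquiv v : ℕ) ≠ p ∧ ¬ p ∣ (W₁.baseChange (v.adicCompletion ℚ)).localTamagawaNumber
        (v.adicCompletionIntegers ℚ) * reductionPointCount W₁ (primesEquiv v : ℕ))
    (hgood₁ : ∀ v ∉ S₁, (p : 𝓞 ℚ) ∉ v.asIdeal ∧ W₁.HasGoodReductionAt v)
    {κ : ZpExtension ℚ p} {γ : Field.absoluteGaloisGroup ℚ}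
    (_hκ : κ.IsCyclotomic) (hγ : κ.IsTopGenerator γ) (_hγ' : IsCyclotomicVariable p γ)
    (D₁ : W₁.SelmerDualData κ γ) :
    D₁.IsTorsion ∧ D₁.mu = 0 ∧ 0 ≤ lambdaInvariant p D₁.X := by
  haveI := hpm₁.subsingleton_X_of_card_selmer_eq_one_numeric hT41 hp2 D₁ hγ hSel₁ S₁ hS₁ hgood₁
  exact ⟨isTorsion_of_subsingleton D₁, mu_eq_zero_of_subsingleton D₁, Nat.zero_le _⟩

/-- **The partner input `h₁` (with `r₁ = 0`) for a TRIVIAL (M)-at-`p` partner, `p ≥ 5`, additive or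
numerically tested bad places** (mod A41). [cite: GreenbergLNM1716, §3 Prop. 3.8 and Remark (pp. 95–96)] -/
theorem PotMult.partnerInput_of_card_selmer_eq_one_of_additive_away
    (hT41 : Silverman1994_thmV53_corV54_tateUniformisation.{0}) (hpm₁ : PotMult W₁ p) (hp5 : 5 ≤ p)
    (hSel₁ : Nat.card (W₁.selmerGroupPInfty p) = 1) (S₁ : Finset (HeightOneSpectrum (𝓞 ℚ)))
    (hS₁ : ∀ v ∈ S₁, (p : 𝓞 ℚ) ∉ v.asIdeal → W₁.HasAdditiveReductionAt v ∨
      ((primesEquiv v : ℕ) ≠ p ∧ ¬ p ∣ (W₁.baseChange (v.adicCompletion ℚ)).localTamagawaNumber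
        (v.adicCompletionIntegers ℚ) * reductionPointCount W₁ (primesEquiv v : ℕ)))
    (hgood₁ : ∀ v ∉ S₁, (p : 𝓞 ℚ) ∉ v.asIdeal ∧ W₁.HasGoodReductionAt v)
    {κ : ZpExtension ℚ p} {γ : Field.absoluteGaloisGroup ℚ}
    (_hκ : κ.IsCyclotomic) (hγ : κ.IsTopGenerator γ) (_hγ' : IsCyclotomicVariable p γ)
    (D₁ : W₁.SelmerDualData κ γ) :
    D₁.IsTorsion ∧ D₁.mu = 0 ∧ 0 ≤ lambdaInvariant p D₁.X := by
  haveI := hpm₁.subsingleton_X_of_card_selmer_eq_one_of_additive_away hT41 hp5 D₁ hγ hSel₁ S₁ hS₁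
    hgood₁
  exact ⟨isTorsion_of_subsingleton D₁, mu_eq_zero_of_subsingleton D₁, Nat.zero_le _⟩

/-- **X4(M) ∧ surj(p) ∧ `r_an = 0`, EVERY odd `p` (`p = 3` included): `BSD(E,p)` from the record at
index `b ≤ e` and a TRIVIAL (M)-at-`p` CONGRUENT PARTNER** — `TorsionIso W W₁ p`,
`CongruentLambdaShift W W₁ p e`, and on the partner ONLY `PotMult W₁ p`, `#Sel_{p^∞}(E₁/ℚ) = 1` and
the numeric tests `p ∤ c_ℓ · #Ẽ_ns(𝔽_ℓ)` at its bad `ℓ ≠ p` (no Kato half, no unit-coefficient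
certificate, no surjectivity on the partner side). = the tree's
`ClassX4M.bsdp_rankZero_of_surj_of_katoHalf_of_firstUnitIndex_of_congruentPartner` with
`h₁ := PotMult.partnerInput_of_card_selmer_eq_one_numeric`, `r₁ := 0`. PER PAIR; mod A41 and the
receiver-side facts of record; X4(M) stays CONSTRUCTION-SHAPED; nothing booked.
[cite: Kato2004Asterisque, Thm. 17.4 (3) (p. 273)] [cite: Delbourgo1998, Prop. 4 (p. 144)]
[cite: GreenbergLNM1716, §3 Prop. 3.8 and Remark (pp. 95–96)] [cite: Pal2012, Thm. 3.2] [cite: Miller2011LMS, Def. 1.1] -/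
theorem ClassX4M.bsdp_rankZero_of_surj_of_katoHalf_of_firstUnitIndex_of_trivialPotMultPartner
    (hK : Wuthrich2014.kato_halfEigenCharIdeal_dvd_cyclotomicPrime_of_surjective)
    (hDel : Delbourgo1998.prop4_rankZero_pow_dvd_constantCoeff)
    (hDelX : Delbourgo1998.prop4_rankZero_constantCoeff_eq_unit_mul_of_potMult)
    (hPal : Pal2012.thm32_sqrt_mul_realPeriodRat_twist_eq_of_prime_one_mod_four)
    (hGZK : rank_eq_analyticRank_of_analyticRank_le_one) (hmod : hasEntireLFunction_rat)
    (hmodD : nonempty_modularParametrizationData)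
    (hT41 : Silverman1994_thmV53_corV54_tateUniformisation.{0})
    (hX : ClassX4M W p) (hsurj : Surj W p) (hr : W.analyticRank = 0) {b : ℕ}
    (hrec : (p % 4 = 1 → MultFirstUnitIndexAt W p b) ∧ (p % 4 = 3 → MultOddFirstUnitIndexAt W p b))
    {e : ℤ} (hiso : TorsionIso W W₁ p) (hG : CongruentLambdaShift W W₁ p e)
    (hpm₁ : PotMult W₁ p) (hSel₁ : Nat.card (W₁.selmerGroupPInfty p) = 1)
    (S₁ : Finset (HeightOneSpectrum (𝓞 ℚ)))
    (hS₁ : ∀ v ∈ S₁, (p : 𝓞 ℚ) ∉ v.asIdeal →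
      (primesEquiv v : ℕ) ≠ p ∧ ¬ p ∣ (W₁.baseChange (v.adicCompletion ℚ)).localTamagawaNumber
        (v.adicCompletionIntegers ℚ) * reductionPointCount W₁ (primesEquiv v : ℕ))
    (hgood₁ : ∀ v ∉ S₁, (p : 𝓞 ℚ) ∉ v.asIdeal ∧ W₁.HasGoodReductionAt v)
    (hb : (b : ℤ) ≤ e) : BSDp W p :=
  hX.bsdp_rankZero_of_surj_of_katoHalf_of_firstUnitIndex_of_congruentPartner hK hDel hDelX hPal hGZK hmod
    hmodD hsurj hr hrec hiso hG (r₁ := 0)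
    (fun hκ hγ hγ' D₁ _ ↦
      hpm₁.partnerInput_of_card_selmer_eq_one_numeric hT41 hX.p_ne_two hSel₁ S₁ hS₁ hgood₁ hκ hγ hγ' D₁)
    (by simpa using hb)

/-- **X4(M) ∧ surj(p) ∧ `r_an = 0`, `p ≥ 5`: `BSD(E,p)` from the record at index `b ≤ e` and a TRIVIAL
(M)-at-`p` congruent partner whose bad places away from `p` are additive or numerically tested.**
PER PAIR; mod A41 and the receiver-side facts of record; nothing booked.
[cite: Kato2004Asterisque, Thm. 17.4 (3) (p. 273)] [cite: Delbourgo1998, Prop. 4 (p. 144)]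
[cite: GreenbergLNM1716, §3 Prop. 3.8 and Remark (pp. 95–96)] [cite: Pal2012, Thm. 3.2] [cite: Miller2011LMS, Def. 1.1] -/
theorem ClassX4M.bsdp_rankZero_of_surj_of_katoHalf_of_firstUnitIndex_of_trivialPotMultPartner_of_additive_away
    (hK : Wuthrich2014.kato_halfEigenCharIdeal_dvd_cyclotomicPrime_of_surjective)
    (hDel : Delbourgo1998.prop4_rankZero_pow_dvd_constantCoeff)
    (hDelX : Delbourgo1998.prop4_rankZero_constantCoeff_eq_unit_mul_of_potMult)
    (hPal : Pal2012.thm32_sqrt_mul_realPeriodRat_twist_eq_of_prime_one_mod_four)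
    (hGZK : rank_eq_analyticRank_of_analyticRank_le_one) (hmod : hasEntireLFunction_rat)
    (hmodD : nonempty_modularParametrizationData)
    (hT41 : Silverman1994_thmV53_corV54_tateUniformisation.{0})
    (hX : ClassX4M W p) (hsurj : Surj W p) (hr : W.analyticRank = 0) (hp5 : 5 ≤ p) {b : ℕ}
    (hrec : (p % 4 = 1 → MultFirstUnitIndexAt W p b) ∧ (p % 4 = 3 → MultOddFirstUnitIndexAt W p b))
    {e : ℤ} (hiso : TorsionIso W W₁ p) (hG : CongruentLambdaShift W W₁ p e)
    (hpm₁ : PotMult W₁ p) (hSel₁ : Nat.card (W₁.selmerGroupPInfty p) = 1)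
    (S₁ : Finset (HeightOneSpectrum (𝓞 ℚ)))
    (hS₁ : ∀ v ∈ S₁, (p : 𝓞 ℚ) ∉ v.asIdeal → W₁.HasAdditiveReductionAt v ∨
      ((primesEquiv v : ℕ) ≠ p ∧ ¬ p ∣ (W₁.baseChange (v.adicCompletion ℚ)).localTamagawaNumber
        (v.adicCompletionIntegers ℚ) * reductionPointCount W₁ (primesEquiv v : ℕ)))
    (hgood₁ : ∀ v ∉ S₁, (p : 𝓞 ℚ) ∉ v.asIdeal ∧ W₁.HasGoodReductionAt v)
    (hb : (b : ℤ) ≤ e) : BSDp W p :=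
  hX.bsdp_rankZero_of_surj_of_katoHalf_of_firstUnitIndex_of_congruentPartner hK hDel hDelX hPal hGZK hmod
    hmodD hsurj hr hrec hiso hG (r₁ := 0)
    (fun hκ hγ hγ' D₁ _ ↦
      hpm₁.partnerInput_of_card_selmer_eq_one_of_additive_away hT41 hp5 hSel₁ S₁ hS₁ hgood₁ hκ hγ hγ'
        D₁)
    (by simpa using hb)

/-- **X3♯(M) ∧ `r_an = 0`, EVERY odd `p`: `BSD(E,p)` from the record at index `b ≤ e` and a TRIVIAL
(M)-at-`p` CONGRUENT PARTNER** (`PotMult W₁ p`, `#Sel_{p^∞}(E₁/ℚ) = 1`, numeric tests at its bad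
`ℓ ≠ p`) — NO image hypothesis on either curve, no Kato half / certificate on the partner. = the tree's
`ClassX3M.bsdp_rankZero_of_wuthrichHalf_of_firstUnitIndex_of_congruentPartner` with
`h₁ := PotMult.partnerInput_of_card_selmer_eq_one_numeric`, `r₁ := 0`. PER PAIR; mod A41 and the
receiver-side facts of record; X3♯(M) stays CONSTRUCTION-SHAPED; nothing booked.
[cite: Wuthrich2014, Thm. 16 (p. 397)] [cite: Delbourgo1998, Prop. 4 (p. 144)]
[cite: GreenbergLNM1716, §3 Prop. 3.8 and Remark (pp. 95–96)] [cite: Pal2012, Thm. 3.2] -/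
theorem ClassX3M.bsdp_rankZero_of_wuthrichHalf_of_firstUnitIndex_of_trivialPotMultPartner
    (hW16 : Wuthrich2014.thm16_halfEigenCharIdeal_dvd_cyclotomicPrime)
    (hDel : Delbourgo1998.prop4_rankZero_pow_dvd_constantCoeff)
    (hDelX : Delbourgo1998.prop4_rankZero_constantCoeff_eq_unit_mul_of_potMult)
    (hPal : Pal2012.thm32_sqrt_mul_realPeriodRat_twist_eq_of_prime_one_mod_four)
    (hGZK : rank_eq_analyticRank_of_analyticRank_le_one) (hmod : hasEntireLFunction_rat)
    (hmodD : nonempty_modularParametrizationData)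
    (hT41 : Silverman1994_thmV53_corV54_tateUniformisation.{0})
    (hX : ClassX3M W p) (hr : W.analyticRank = 0) {b : ℕ}
    (hrec : (p % 4 = 1 → MultFirstUnitIndexAt W p b) ∧ (p % 4 = 3 → MultOddFirstUnitIndexAt W p b))
    {e : ℤ} (hiso : TorsionIso W W₁ p) (hG : CongruentLambdaShift W W₁ p e)
    (hpm₁ : PotMult W₁ p) (hSel₁ : Nat.card (W₁.selmerGroupPInfty p) = 1)
    (S₁ : Finset (HeightOneSpectrum (𝓞 ℚ)))
    (hS₁ : ∀ v ∈ S₁, (p : 𝓞 ℚ) ∉ v.asIdeal →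
      (primesEquiv v : ℕ) ≠ p ∧ ¬ p ∣ (W₁.baseChange (v.adicCompletion ℚ)).localTamagawaNumber
        (v.adicCompletionIntegers ℚ) * reductionPointCount W₁ (primesEquiv v : ℕ))
    (hgood₁ : ∀ v ∉ S₁, (p : 𝓞 ℚ) ∉ v.asIdeal ∧ W₁.HasGoodReductionAt v)
    (hb : (b : ℤ) ≤ e) : BSDp W p :=
  hX.bsdp_rankZero_of_wuthrichHalf_of_firstUnitIndex_of_congruentPartner hW16 hDel hDelX hPal hGZK hmod
    hmodD hr hrec hiso hG (r₁ := 0)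
    (fun hκ hγ hγ' D₁ _ ↦
      hpm₁.partnerInput_of_card_selmer_eq_one_numeric hT41 (ClassX3M.p_ne_two W p hX) hSel₁ S₁ hS₁
        hgood₁ hκ hγ hγ' D₁)
    (by simpa using hb)

end Summit.BirchSwinnertonDyer.Rank1Residual.AdditivePotMult

end
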